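import Literature.MathematicalPhysics.QuantumFieldTheory.ConformalBootstrap3D.RadialIntegerArray
import Literature.MathematicalPhysics.QuantumFieldTheory.ConformalBootstrap3D.BlockExchangeIdentity
import Literature.Analysis.Calculus.SeparatelyAnalyticIdentity
import HarnessLib

/-!
# The signed radial expansion of the `⟨σεσε⟩` block is a CONSEQUENCE of the radial expansion of the
`⟨εσσε⟩` block (Dolan–Osborn 2011 eq. (2.23) in the radial frame, on the whole square)

In the radial-frame odd sector of the pub-ising3d `σ–ε` certificate (`MixedOddRadial`,
`MixedOddRadialRules`) the would-be block clause `RadialPairClause` posits, for the typed pair of blocks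
`g₁ = g^{s,s}_{Δ,ℓ}` (`⟨σεσε⟩`) and `g₂ = g^{-s,s}_{Δ,ℓ}` (`⟨εσσε⟩`), `s = Δσ - Δε`, a common table `w`
with `HasRadialExpansion (s/2) Δ w g₂` (Costa–Hansen–Penedones–Trevisani 2016 eq. (2.11):
`v^{s/2} g₂ = 4^Δ Σ w(m,j) r^{Δ+m} P_j(η)`) AND `HasSignedRadialExpansion Δ w g₁`
(`g₁ = 4^Δ Σ (-1)^m w(m,j) r^{Δ+m} P_j(η)`). The second is the radial form of Dolan–Osborn's
`x₁ ↔ x₂` exchange relation (2.23), `g^{s,s}(z,z̄) = (-1)^ℓ v^{-s/2} g^{-s,s}(z/(z-1), z̄/(z̄-1))`, under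
which `z ↦ z/(z-1)` is `ρ ↦ -ρ` (Hogervorst–Rychkov 2013 §3). This file PROVES the second from the
first, at every regular `(Δ, ℓ)` strictly above the unitarity bound:

* `IsConformalBlock3D.hasSignedRadialExpansion_of_hasRadialExpansion` — for typed `g₁`, `g₂` as above
  and any table `w` supported on `j ≤ ℓ + m`, `HasRadialExpansion (s/2) Δ w g₂ → HasSignedRadialExpansion Δ w g₁`;
* `radialPairClause_of_hasRadialExpansion` — hence `RadialPairClause Δσ Δε Δ ℓ` follows from the
  `⟨εσσε⟩` (reflection-positive) expansion alone: the signed half of the clause is redundant.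

Proof (Hogervorst–Rychkov 2013 §3.1 "the block continues to the `ρ`-disc", carried out one real
variable at a time). Write `z = z(ρ) = 4ρ/(1+ρ)²` and
`G(ρ,ρ̄) := (4/(1+ρ)²)^α (4/(1+ρ̄)²)^α ((1-z)(1-z̄))^c K(z,z̄)` (`blockRho`; `α = (Δ-ℓ)/2`, `K` the
Dolan–Osborn double series of the block), so that `(ρρ̄)^α G = v^c g(z(ρ),z(ρ̄))` whenever `ρρ̄ ≥ 0`
(`mul_blockRho_eq`). `G` is real-analytic in each variable separately on `I = (-(3-2√2), 1)` (there
`|z(ρ)| < 1`; power series in one variable, `Literature.Analysis.Calculus`). (A) By `RadialIntegerArray`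
the radial hypothesis says `G₂ = T` on `(0,1)²`, `T(ρ,ρ̄) = Σ M(a,b) ρ^a ρ̄^b` the integer-exponent
regrouping of the radial series (absolutely convergent on the unit square, hence separately analytic on
`(-1,1)`); the identity theorem in `ρ` then in `ρ̄` (`eqOn_of_separatelyAnalyticOn`) gives `G₂ = T` on
`I²`, in particular at NEGATIVE `(ρ,ρ̄) ∈ (-(3-2√2),0)²`. (B) For `x, y ∈ (0,½)` the landed `z`-frame
form of (2.23) (`IsConformalBlock3DAbove.eq_exch`, `BlockExchangeIdentity`) evaluates `g₁(x,y)` through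
`g₂` at `(x/(x-1), y/(y-1)) = (z(-ρ(x)), z(-ρ(y)))`; with (A): `g₁(x,y) = (-1)^ℓ (ρρ̄)^α T(-ρ,-ρ̄)`,
`ρ = ρ(x) < 3-2√2`. (C) Both sides of the last identity, divided by `(ρρ̄)^α`, are separately analytic
on `I` (`G₁` with `c = 0`, and `T(-ρ,-ρ̄)`); a second application of the identity theorem extends it
from `(0,3-2√2)²` to `(0,1)²`. (D) Regrouping the SIGNED radial series (`radialIntArr_signed`: the level
sign `(-1)^m` is the monomial sign `(-1)^{ℓ+a+b}`) identifies its sum with `(-1)^ℓ (ρρ̄)^α T(-ρ,-ρ̄)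
= g₁`. No positivity of `w` is used; no value of a coefficient is computed.

What is NOT here: existence of the radial expansion of `g₂` on the square (the remaining content of a
clause A2ρ; by `RadialExistenceOfPositivity` it follows from non-negativity of the table).

Sources: F. A. Dolan, H. Osborn, arXiv:1108.6194, §2 eq. (2.23); M. Hogervorst, S. Rychkov,
Phys. Rev. D 87 (2013) 106004, arXiv:1303.1111, §3, §3.1; M. S. Costa, T. Hansen, J. Penedones,
E. Trevisani, JHEP 07 (2016) 057, arXiv:1603.05552, §2.1 eq. (2.11); M. Field, *Essential Real Analysis*
(2017) §5.4 (identity theorem). Tree: `hrBlockAB`, `hrSeriesAB`, `isDoublePowerSeriesOn_hrSeriesAB`,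
`IsConformalBlock3DAbove.eq_exch`, `IsConformalBlock3DAbove.eq_hrBlockAB`, `zOfRho`, `rhoOf`,
`div_self_sub_one_eq_zOfRho_neg_rhoOf`, `radialIntArr`, `HasRadialExpansion.hasSum_radialIntArr`,
`radialIntArr_signed`, `IsConformalBlock3D.radial_paritySupport`, `eqOn_of_separatelyAnalyticOn`.
-/

namespace Literature.MathematicalPhysics.QuantumFieldTheory.ConformalBootstrap3D

open Set Filter Topology Finset
open Literature.Analysis.Calculus

/-! ### The radial threshold `3 - 2√2 = ρ(½)` and the range of `z(ρ)` -/

/-- `0 < 3 - 2√2`. [cite: HogervorstRychkov2013, §3 eq. (3.1)] -/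
theorem radialHalf_pos : 0 < 3 - 2 * Real.sqrt 2 := by
  rw [← rhoOf_half]; exact rhoOf_pos (by norm_num)

/-- `3 - 2√2 < 1`. [cite: HogervorstRychkov2013, §3 eq. (3.1)] -/
theorem radialHalf_lt_one : 3 - 2 * Real.sqrt 2 < 1 := by
  rw [← rhoOf_half]; exact rhoOf_lt_one (by norm_num)

/-- For `ρ > -(3-2√2)`: `z(ρ) > -1` (indeed `z(ρ) + 1 = (ρ² + 6ρ + 1)/(1+ρ)²` and `ρ + 3 > 2√2`).
[cite: HogervorstRychkov2013, §3 eq. (3.1)] -/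
theorem neg_one_lt_zOfRho {ρ : ℝ} (hρ : -(3 - 2 * Real.sqrt 2) < ρ) : -1 < zOfRho ρ := by
  have h2 : Real.sqrt 2 ^ 2 = 2 := Real.sq_sqrt (by norm_num)
  have hs : 0 < Real.sqrt 2 := Real.sqrt_pos.mpr (by norm_num)
  have h3 : 2 * Real.sqrt 2 < ρ + 3 := by linarith
  have hq : 8 < (ρ + 3) ^ 2 := by nlinarith
  have hp : 0 < (1 + ρ) ^ 2 := by nlinarith
  rw [zOfRho_def, lt_div_iff₀ hp]
  nlinarith

/-- For `-(3-2√2) < ρ < 1`: `|z(ρ)| < 1`. [cite: HogervorstRychkov2013, §3 eq. (3.1)] -/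
theorem abs_zOfRho_lt_one {ρ : ℝ} (hρ0 : -(3 - 2 * Real.sqrt 2) < ρ) (hρ1 : ρ < 1) :
    |zOfRho ρ| < 1 := by
  have h0 : -1 < ρ := lt_trans (by linarith [radialHalf_lt_one]) hρ0
  exact abs_lt.2 ⟨neg_one_lt_zOfRho hρ0, zOfRho_lt_one h0 hρ1.ne⟩

/-- For `0 < ρ < 3 - 2√2`: `0 < z(ρ) < ½`. [cite: HogervorstRychkov2013, §3 eq. (3.1)] -/
theorem zOfRho_lt_half {ρ : ℝ} (hρ0 : 0 < ρ) (hρ1 : ρ < 3 - 2 * Real.sqrt 2) : zOfRho ρ < 1 / 2 := by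
  by_contra h
  rw [not_lt] at h
  have hz1 : zOfRho ρ ≤ 1 := zOfRho_le_one (by linarith)
  have hρ' : rhoOf (zOfRho ρ) = ρ := rhoOf_zOfRho (by linarith) (by linarith [radialHalf_lt_one])
  rcases h.lt_or_eq with hlt | heq
  · have := rhoOf_lt_rhoOf hlt hz1
    rw [rhoOf_half, hρ'] at this
    linarith
  · have := congrArg rhoOf heq
    rw [rhoOf_half, hρ'] at this
    linarith

/-- For `0 < x < ½`: `0 < ρ(x) < 3 - 2√2`. [cite: HogervorstRychkov2013, §3 eq. (3.1)] -/
theorem rhoOf_lt_radialHalf {x : ℝ} (hx1 : x < 1 / 2) : rhoOf x < 3 - 2 * Real.sqrt 2 := by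
  rw [← rhoOf_half]; exact rhoOf_lt_rhoOf hx1 (by norm_num)

/-! ### The block in the radial frame, stripped of `(ρρ̄)^α` -/

/-- **The `ρ`-frame block function** `G(ρ,ρ̄) := (4/(1+ρ)²)^α (4/(1+ρ̄)²)^α ((1-z)(1-z̄))^c K^{ab}(z,z̄)`,
`z = z(ρ)`, `z̄ = z(ρ̄)`, `α = (Δ-ℓ)/2`, `a = -Δ₁₂/2`, `b = Δ₃₄/2`, `K^{ab}` the Dolan–Osborn double
series (`hrSeriesAB`): the prefactored block `v^c g^{Δ₁₂,Δ₃₄}_{Δ,ℓ}(z(ρ),z(ρ̄))` divided by `(ρρ̄)^α`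
(`mul_blockRho_eq`), written so that every factor is real-analytic in each of `ρ, ρ̄ ∈ (-(3-2√2), 1)`
separately, also across `ρ = 0` and at mixed signs (Hogervorst–Rychkov 2013 §3.1: the block as a
function on the `ρ`-disc). [cite: HogervorstRychkov2013, §3.1] -/
noncomputable def blockRho (Δ₁₂ Δ₃₄ Δ c : ℝ) (ℓ : ℕ) (ρ ρb : ℝ) : ℝ :=
  (4 / (1 + ρ) ^ 2) ^ ((Δ - (ℓ : ℝ)) / 2) * (4 / (1 + ρb) ^ 2) ^ ((Δ - (ℓ : ℝ)) / 2) *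
    (((1 - zOfRho ρ) * (1 - zOfRho ρb)) ^ c *
      hrSeriesAB (-Δ₁₂ / 2) (Δ₃₄ / 2) Δ ℓ (zOfRho ρ) (zOfRho ρb))

/-- `z(ρ) = ρ · 4/(1+ρ)²`. [cite: HogervorstRychkov2013, §3 eq. (3.1)] -/
theorem zOfRho_eq_mul (ρ : ℝ) : zOfRho ρ = ρ * (4 / (1 + ρ) ^ 2) := by
  rw [zOfRho_def]; ring

/-- **`(ρρ̄)^α G(ρ,ρ̄) = ((1-z)(1-z̄))^c g^{Δ₁₂,Δ₃₄}_{Δ,ℓ}(z,z̄)`** at `z = z(ρ)`, `z̄ = z(ρ̄)`, whenever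
`ρρ̄ ≥ 0` (both in `(0,1)`, or both negative — where `hrBlockAB` is the `z`-series continuation).
[cite: HogervorstRychkov2013, §3.1] -/
theorem mul_blockRho_eq (Δ₁₂ Δ₃₄ Δ c : ℝ) (ℓ : ℕ) {ρ ρb : ℝ} (hρρb : 0 ≤ ρ * ρb) :
    (ρ * ρb) ^ ((Δ - (ℓ : ℝ)) / 2) * blockRho Δ₁₂ Δ₃₄ Δ c ℓ ρ ρb =
      ((1 - zOfRho ρ) * (1 - zOfRho ρb)) ^ c *
        hrBlockAB Δ₁₂ Δ₃₄ Δ ℓ (zOfRho ρ) (zOfRho ρb) := by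
  have h1 : 0 ≤ 4 / (1 + ρ) ^ 2 := by positivity
  have h2 : 0 ≤ 4 / (1 + ρb) ^ 2 := by positivity
  have hz : zOfRho ρ * zOfRho ρb = (ρ * ρb) * ((4 / (1 + ρ) ^ 2) * (4 / (1 + ρb) ^ 2)) := by
    rw [zOfRho_eq_mul, zOfRho_eq_mul]; ring
  unfold blockRho hrBlockAB
  rw [hz, Real.mul_rpow hρρb (mul_nonneg h1 h2), Real.mul_rpow h1 h2]
  ring

/-! ### Separate analyticity of `G` on `I = (-(3-2√2), 1)` -/

/-- `z(ρ)` is real-analytic at `ρ ≠ -1`. [cite: HogervorstRychkov2013, §3 eq. (3.1)] -/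
theorem analyticAt_zOfRho {ρ : ℝ} (hρ : ρ ≠ -1) : AnalyticAt ℝ zOfRho ρ := by
  have h : zOfRho = fun ρ : ℝ => 4 * ρ / (1 + ρ) ^ 2 := funext zOfRho_def
  rw [h]
  have hne : (1 + ρ) ^ 2 ≠ 0 := by
    have : 1 + ρ ≠ 0 := fun h0 => hρ (by linarith)
    positivity
  exact (analyticAt_const.mul analyticAt_id).div ((analyticAt_const.add analyticAt_id).pow 2) hne

/-- `ρ ↦ (4/(1+ρ)²)^α` is real-analytic at `ρ ≠ -1`. [cite: HogervorstRychkov2013, §3.1] -/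
theorem analyticAt_pref_rpow {ρ : ℝ} (hρ : ρ ≠ -1) (α : ℝ) :
    AnalyticAt ℝ (fun t : ℝ => (4 / (1 + t) ^ 2) ^ α) ρ := by
  have hne1 : 1 + ρ ≠ 0 := fun h0 => hρ (by linarith)
  have hne : (1 + ρ) ^ 2 ≠ 0 := by positivity
  have hf : AnalyticAt ℝ (fun t : ℝ => 4 / (1 + t) ^ 2) ρ :=
    analyticAt_const.div ((analyticAt_const.add analyticAt_id).pow 2) hne
  have hpos : 0 < 4 / (1 + ρ) ^ 2 := by positivity
  exact analyticAt_rpow_const_of_pos hf hpos α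

/-- `1 - z(ρ) > 0` for `ρ ∈ (-1,1)`. [cite: HogervorstRychkov2013, §3 eq. (3.1)] -/
theorem one_sub_zOfRho_pos {ρ : ℝ} (h0 : -1 < ρ) (h1 : ρ < 1) : 0 < 1 - zOfRho ρ := by
  linarith [zOfRho_lt_one h0 h1.ne]

/-- The Dolan–Osborn double series `z ↦ K^{ab}(z, z̄₀)` is real-analytic on `(-1,1)` for `|z̄₀| < 1`
(power series in one variable with radius `≥ 1`). [cite: DolanOsborn2004, §3 eqs. (3.10)–(3.11)] -/
theorem analyticOnNhd_hrSeriesAB_fst {a b Δ : ℝ} {ℓ : ℕ} (hΔ : unitarityBound3D ℓ < Δ) {zb : ℝ}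
    (hzb : |zb| < 1) :
    AnalyticOnNhd ℝ (fun z : ℝ => hrSeriesAB a b Δ ℓ z zb) (Ioo (-1) 1) := by
  have hS := isDoublePowerSeriesOn_hrSeriesAB (a := a) (b := b) hΔ
  have hM : ∀ r t : ℝ, 0 ≤ r → r < 1 → 0 ≤ t → t < 1 →
      Summable fun p : ℕ × ℕ => |hrMonomialCoeffAB a b Δ ℓ p| * r ^ p.1 * t ^ p.2 := by
    intro r t hr0 hr1 ht0 ht1
    have h := (hS r t (by rwa [abs_of_nonneg hr0]) (by rwa [abs_of_nonneg ht0])).1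
    simpa only [abs_of_nonneg hr0, abs_of_nonneg ht0] using h
  exact analyticOnNhd_tsum_prod_fst hM hzb

/-- The same in the second variable. [cite: DolanOsborn2004, §3 eqs. (3.10)–(3.11)] -/
theorem analyticOnNhd_hrSeriesAB_snd {a b Δ : ℝ} {ℓ : ℕ} (hΔ : unitarityBound3D ℓ < Δ) {z : ℝ}
    (hz : |z| < 1) :
    AnalyticOnNhd ℝ (fun zb : ℝ => hrSeriesAB a b Δ ℓ z zb) (Ioo (-1) 1) := by
  have hS := isDoublePowerSeriesOn_hrSeriesAB (a := a) (b := b) hΔ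
  have hM : ∀ r t : ℝ, 0 ≤ r → r < 1 → 0 ≤ t → t < 1 →
      Summable fun p : ℕ × ℕ => |hrMonomialCoeffAB a b Δ ℓ p| * r ^ p.1 * t ^ p.2 := by
    intro r t hr0 hr1 ht0 ht1
    have h := (hS r t (by rwa [abs_of_nonneg hr0]) (by rwa [abs_of_nonneg ht0])).1
    simpa only [abs_of_nonneg hr0, abs_of_nonneg ht0] using h
  exact analyticOnNhd_tsum_prod_snd hM hz

/-- **`G` is real-analytic in `ρ` on `(-(3-2√2), 1)`** for each fixed `ρ̄` there.
[cite: HogervorstRychkov2013, §3.1] -/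
theorem analyticOnNhd_blockRho_fst {Δ₁₂ Δ₃₄ Δ : ℝ} {ℓ : ℕ} (hΔ : unitarityBound3D ℓ < Δ) (c : ℝ)
    {ρb : ℝ} (hρb0 : -(3 - 2 * Real.sqrt 2) < ρb) (hρb1 : ρb < 1) :
    AnalyticOnNhd ℝ (fun ρ => blockRho Δ₁₂ Δ₃₄ Δ c ℓ ρ ρb) (Ioo (-(3 - 2 * Real.sqrt 2)) 1) := by
  intro ρ hρ
  have hρm1 : -1 < ρ := lt_trans (by linarith [radialHalf_lt_one]) hρ.1
  have hρbm1 : -1 < ρb := lt_trans (by linarith [radialHalf_lt_one]) hρb0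
  have hne : ρ ≠ -1 := hρm1.ne'
  have hz : |zOfRho ρ| < 1 := abs_zOfRho_lt_one hρ.1 hρ.2
  have hzb : |zOfRho ρb| < 1 := abs_zOfRho_lt_one hρb0 hρb1
  -- the four factors
  have h1 : AnalyticAt ℝ (fun t : ℝ => (4 / (1 + t) ^ 2) ^ ((Δ - (ℓ : ℝ)) / 2)) ρ :=
    analyticAt_pref_rpow hne _
  have h2 : AnalyticAt ℝ (fun _ : ℝ => (4 / (1 + ρb) ^ 2) ^ ((Δ - (ℓ : ℝ)) / 2)) ρ :=
    analyticAt_const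
  have h3 : AnalyticAt ℝ (fun t : ℝ => ((1 - zOfRho t) * (1 - zOfRho ρb)) ^ c) ρ := by
    have hf : AnalyticAt ℝ (fun t : ℝ => (1 - zOfRho t) * (1 - zOfRho ρb)) ρ :=
      (analyticAt_const.sub (analyticAt_zOfRho hne)).mul analyticAt_const
    exact analyticAt_rpow_const_of_pos hf
      (mul_pos (one_sub_zOfRho_pos hρm1 hρ.2) (one_sub_zOfRho_pos hρbm1 hρb1)) c
  have h4 : AnalyticAt ℝ (fun t : ℝ => hrSeriesAB (-Δ₁₂ / 2) (Δ₃₄ / 2) Δ ℓ (zOfRho t) (zOfRho ρb)) ρ :=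
    (analyticOnNhd_hrSeriesAB_fst hΔ hzb (zOfRho ρ) (abs_lt.1 hz)).comp (analyticAt_zOfRho hne)
  exact (h1.mul h2).mul (h3.mul h4)

/-- **`G` is real-analytic in `ρ̄` on `(-(3-2√2), 1)`** for each fixed `ρ` there.
[cite: HogervorstRychkov2013, §3.1] -/
theorem analyticOnNhd_blockRho_snd {Δ₁₂ Δ₃₄ Δ : ℝ} {ℓ : ℕ} (hΔ : unitarityBound3D ℓ < Δ) (c : ℝ)
    {ρ : ℝ} (hρ0 : -(3 - 2 * Real.sqrt 2) < ρ) (hρ1 : ρ < 1) :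
    AnalyticOnNhd ℝ (fun ρb => blockRho Δ₁₂ Δ₃₄ Δ c ℓ ρ ρb) (Ioo (-(3 - 2 * Real.sqrt 2)) 1) := by
  intro ρb hρb
  have hρm1 : -1 < ρ := lt_trans (by linarith [radialHalf_lt_one]) hρ0
  have hρbm1 : -1 < ρb := lt_trans (by linarith [radialHalf_lt_one]) hρb.1
  have hne : ρb ≠ -1 := hρbm1.ne'
  have hz : |zOfRho ρ| < 1 := abs_zOfRho_lt_one hρ0 hρ1
  have hzb : |zOfRho ρb| < 1 := abs_zOfRho_lt_one hρb.1 hρb.2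
  have h1 : AnalyticAt ℝ (fun _ : ℝ => (4 / (1 + ρ) ^ 2) ^ ((Δ - (ℓ : ℝ)) / 2)) ρb :=
    analyticAt_const
  have h2 : AnalyticAt ℝ (fun t : ℝ => (4 / (1 + t) ^ 2) ^ ((Δ - (ℓ : ℝ)) / 2)) ρb :=
    analyticAt_pref_rpow hne _
  have h3 : AnalyticAt ℝ (fun t : ℝ => ((1 - zOfRho ρ) * (1 - zOfRho t)) ^ c) ρb := by
    have hf : AnalyticAt ℝ (fun t : ℝ => (1 - zOfRho ρ) * (1 - zOfRho t)) ρb :=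
      analyticAt_const.mul (analyticAt_const.sub (analyticAt_zOfRho hne))
    exact analyticAt_rpow_const_of_pos hf
      (mul_pos (one_sub_zOfRho_pos hρm1 hρ1) (one_sub_zOfRho_pos hρbm1 hρb.2)) c
  have h4 : AnalyticAt ℝ (fun t : ℝ => hrSeriesAB (-Δ₁₂ / 2) (Δ₃₄ / 2) Δ ℓ (zOfRho ρ) (zOfRho t)) ρb :=
    (analyticOnNhd_hrSeriesAB_snd hΔ hz (zOfRho ρb) (abs_lt.1 hzb)).comp (analyticAt_zOfRho hne)
  exact (h1.mul h2).mul (h3.mul h4)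

/-! ### (A) The radial hypothesis continues `G₂` to negative `ρ` -/

/-- Convergence of the integer-exponent series at every `|ρ|, |ρ̄| < 1`. [folklore] -/
private theorem hasSum_tsum_of_abs {M : ℕ × ℕ → ℝ}
    (hM : ∀ r t : ℝ, 0 ≤ r → r < 1 → 0 ≤ t → t < 1 →
      Summable fun p : ℕ × ℕ => |M p| * r ^ p.1 * t ^ p.2)
    {x y : ℝ} (hx : |x| < 1) (hy : |y| < 1) :
    HasSum (fun p : ℕ × ℕ => M p * x ^ p.1 * y ^ p.2) (∑' p : ℕ × ℕ, M p * x ^ p.1 * y ^ p.2) := by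
  refine (Summable.of_norm_bounded (hM |x| |y| (abs_nonneg x) hx (abs_nonneg y) hy)
    fun p => ?_).hasSum
  rw [Real.norm_eq_abs, abs_mul, abs_mul, abs_pow, abs_pow]

/-- **Step (A): the radial table expands `G` on the whole square `I²`, `I = (-(3-2√2), 1)`.**
For a typed block `g = g^{Δ₁₂,Δ₃₄}_{Δ,ℓ}` at a regular point and a supported, parity-supported table `w`
with `HasRadialExpansion c Δ w g`, the integer-exponent double power series of the table sums to
`G(ρ,ρ̄)` at every `ρ, ρ̄ ∈ I` — including negative arguments, where `G` is the `z`-series continuation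
(Hogervorst–Rychkov 2013 §3.1; identity theorem in each variable). [cite: HogervorstRychkov2013, §3.1] -/
theorem IsConformalBlock3D.blockRho_eq_tsum_radialIntArr {Δ₁₂ Δ₃₄ Δ c : ℝ} {ℓ : ℕ} {g : ℝ → ℝ → ℝ}
    {w : ℕ × ℕ → ℝ} (hΔ : unitarityBound3D ℓ < Δ) (hreg : ¬ accidentalDegeneracy3D Δ ℓ)
    (hg : IsConformalBlock3D Δ₁₂ Δ₃₄ Δ ℓ g) (hw : RadialSupport ℓ w) (hp : ParitySupport ℓ w)
    (hρ : HasRadialExpansion c Δ w g) :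
    ∀ ρ ∈ Ioo (-(3 - 2 * Real.sqrt 2)) 1, ∀ ρb ∈ Ioo (-(3 - 2 * Real.sqrt 2)) 1,
      blockRho Δ₁₂ Δ₃₄ Δ c ℓ ρ ρb =
        ∑' q : ℕ × ℕ, radialIntArr ℓ (fun p => (4 : ℝ) ^ Δ * w p) q * ρ ^ q.1 * ρb ^ q.2 := by
  have hδ1 := radialHalf_lt_one
  have hδ0 := radialHalf_pos
  have hM := fun r t (hr0 : (0 : ℝ) ≤ r) (hr1 : r < 1) (ht0 : (0 : ℝ) ≤ t) (ht1 : t < 1) =>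
    hρ.summable_abs_radialIntArr hw hp hr0 hr1 ht0 ht1
  have habove : IsConformalBlock3DAbove Δ₁₂ Δ₃₄ Δ ℓ g :=
    (isConformalBlock3D_iff_above_of_isRegularPoint3D ⟨hΔ.ne', hreg⟩).mp hg
  refine eqOn_of_separatelyAnalyticOn (a := -(3 - 2 * Real.sqrt 2)) (b := 1) (a' := 0) (b' := 1)
    (fun t ht => ⟨by linarith [ht.1], ht.2⟩) one_pos
    (fun y hy => analyticOnNhd_blockRho_fst hΔ c hy.1 hy.2)
    (fun y hy => (analyticOnNhd_tsum_prod_fst hM (abs_lt.2 ⟨by linarith [hy.1], hy.2⟩)).mono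
      fun t ht => ⟨by linarith [ht.1], ht.2⟩)
    (fun x hx => analyticOnNhd_blockRho_snd hΔ c hx.1 hx.2)
    (fun x hx => (analyticOnNhd_tsum_prod_snd hM (abs_lt.2 ⟨by linarith [hx.1], hx.2⟩)).mono
      fun t ht => ⟨by linarith [ht.1], ht.2⟩)
    ?_
  -- agreement on the positive square: the radial hypothesis, regrouped
  intro ρ hρI ρb hρbI
  have H := hρ.hasSum_radialIntArr hw hp hρI.1 hρI.2 hρbI.1 hρbI.2
  rw [H.tsum_eq]
  have hX : zOfRho ρ ∈ Ioo (0 : ℝ) 1 := ⟨zOfRho_pos hρI.1, zOfRho_lt_one (by linarith [hρI.1]) hρI.2.ne⟩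
  have hY : zOfRho ρb ∈ Ioo (0 : ℝ) 1 :=
    ⟨zOfRho_pos hρbI.1, zOfRho_lt_one (by linarith [hρbI.1]) hρbI.2.ne⟩
  rw [habove.eq_hrBlockAB hΔ hreg _ _ hX hY, ← mul_blockRho_eq Δ₁₂ Δ₃₄ Δ c ℓ
    (mul_pos hρI.1 hρbI.1).le, ← mul_assoc, Real.rpow_neg (mul_pos hρI.1 hρbI.1).le,
    inv_mul_cancel₀ (Real.rpow_pos_of_pos (mul_pos hρI.1 hρbI.1) _).ne', one_mul]

/-! ### (B) Dolan–Osborn (2.23) at `(x,y) ∈ (0,½)²` through the radial table -/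

/-- `((1 - x/(x-1))(1 - y/(y-1)))^{c} = (1-x)^{-c} (1-y)^{-c}` for `x, y < 1` (`1 - x/(x-1) = 1/(1-x)`:
the exchange map inverts `v`). [cite: DolanOsborn2011, §2 eq. (2.23)] -/
theorem one_sub_exch_mul_rpow {x y : ℝ} (hx : x < 1) (hy : y < 1) (c : ℝ) :
    ((1 - x / (x - 1)) * (1 - y / (y - 1))) ^ c = (1 - x) ^ (-c) * (1 - y) ^ (-c) := by
  have hx' : x - 1 ≠ 0 := by intro h; linarith
  have hy' : y - 1 ≠ 0 := by intro h; linarith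
  have hx'' : 1 - x ≠ 0 := by intro h; linarith
  have hy'' : 1 - y ≠ 0 := by intro h; linarith
  have h1 : 1 - x / (x - 1) = (1 - x)⁻¹ := by
    field_simp
    ring
  have h2 : 1 - y / (y - 1) = (1 - y)⁻¹ := by
    field_simp
    ring
  rw [h1, h2, Real.mul_rpow (inv_nonneg.2 (by linarith)) (inv_nonneg.2 (by linarith)),
    Real.inv_rpow (by linarith), Real.inv_rpow (by linarith), Real.rpow_neg (by linarith),
    Real.rpow_neg (by linarith)]

/-- **Step (B).** For the typed `σ–ε` odd pair (`g₁ = g^{s,s}`, `g₂ = g^{-s,s}`, `s = Δσ - Δε`) at a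
regular point, with `HasRadialExpansion (s/2) Δ w g₂` (`w` supported and parity-supported): for
`x, y ∈ (0,½)`, `g₁(x,y) = (-1)^ℓ (ρρ̄)^α Σ_{a,b} M(a,b) (-ρ)^a (-ρ̄)^b`, `ρ = ρ(x)`, `ρ̄ = ρ(y)`,
`M = radialIntArr ℓ (4^Δ w)` — Dolan–Osborn (2.23) (`BlockExchangeIdentity`) with the continued block
`g₂` at `(x/(x-1), y/(y-1)) = (z(-ρ), z(-ρ̄))` evaluated through step (A).
[cite: DolanOsborn2011, §2 eq. (2.23)] -/
theorem IsConformalBlock3D.eq_signed_tsum_of_lt_half {Δσ Δε Δ : ℝ} {ℓ : ℕ} {g₁ g₂ : ℝ → ℝ → ℝ}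
    {w : ℕ × ℕ → ℝ} (hΔ : unitarityBound3D ℓ < Δ) (hreg : ¬ accidentalDegeneracy3D Δ ℓ)
    (hg₁ : IsConformalBlock3D (Δσ - Δε) (Δσ - Δε) Δ ℓ g₁)
    (hg₂ : IsConformalBlock3D (-(Δσ - Δε)) (Δσ - Δε) Δ ℓ g₂) (hw : RadialSupport ℓ w)
    (hp : ParitySupport ℓ w) (hρ : HasRadialExpansion ((Δσ - Δε) / 2) Δ w g₂) {x y : ℝ}
    (hx0 : 0 < x) (hx1 : x < 1 / 2) (hy0 : 0 < y) (hy1 : y < 1 / 2) :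
    g₁ x y = (-1 : ℝ) ^ ℓ * ((rhoOf x * rhoOf y) ^ ((Δ - (ℓ : ℝ)) / 2) *
      ∑' q : ℕ × ℕ, radialIntArr ℓ (fun p => (4 : ℝ) ^ Δ * w p) q *
        (-rhoOf x) ^ q.1 * (-rhoOf y) ^ q.2) := by
  set s := Δσ - Δε with hs
  have hδ1 := radialHalf_lt_one
  have h1 : IsConformalBlock3DAbove s s Δ ℓ g₁ :=
    (isConformalBlock3D_iff_above_of_isRegularPoint3D ⟨hΔ.ne', hreg⟩).mp hg₁
  -- Dolan–Osborn (2.23) in the `z`-frame, on `(0,½)²`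
  rw [h1.eq_exch hΔ hreg hx0 hx1 hy0 hy1, exchTransform, moebiusExch_def, moebiusExch_def,
    div_self_sub_one_eq_zOfRho_neg_rhoOf (by linarith : x < 1),
    div_self_sub_one_eq_zOfRho_neg_rhoOf (by linarith : y < 1)]
  -- the radial coordinates of the two points
  have hρx0 : 0 < rhoOf x := rhoOf_pos hx0
  have hρy0 : 0 < rhoOf y := rhoOf_pos hy0
  have hρx1 : rhoOf x < 3 - 2 * Real.sqrt 2 := rhoOf_lt_radialHalf hx1
  have hρy1 : rhoOf y < 3 - 2 * Real.sqrt 2 := rhoOf_lt_radialHalf hy1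
  -- step (A) at the negative point
  have hA := hg₂.blockRho_eq_tsum_radialIntArr hΔ hreg hw hp hρ (-rhoOf x)
    ⟨by linarith, by linarith⟩ (-rhoOf y) ⟨by linarith, by linarith⟩
  have hP := mul_blockRho_eq (-s) s Δ (s / 2) ℓ (ρ := -rhoOf x) (ρb := -rhoOf y)
    (by rw [neg_mul_neg]; exact (mul_pos hρx0 hρy0).le)
  rw [neg_mul_neg, hA] at hP
  -- the `v`-prefactor: `(1 - z(-ρ(x))) (1 - z(-ρ(y))) = 1/((1-x)(1-y))`
  have hv : ((1 - zOfRho (-rhoOf x)) * (1 - zOfRho (-rhoOf y))) ^ (s / 2) =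
      (1 - x) ^ (-(s / 2)) * (1 - y) ^ (-(s / 2)) := by
    rw [← div_self_sub_one_eq_zOfRho_neg_rhoOf (by linarith : x < 1),
      ← div_self_sub_one_eq_zOfRho_neg_rhoOf (by linarith : y < 1)]
    exact one_sub_exch_mul_rpow (by linarith) (by linarith) (s / 2)
  rw [hv] at hP
  rw [← hP]

/-! ### (C) Extension from `(0, 3-2√2)²` to the whole square -/

/-- `ρ ↦ Σ M(a,b) (-ρ)^a (-ρ̄₀)^b` is real-analytic on `(-1,1)`. [folklore] -/
private theorem analyticOnNhd_tsum_neg_fst {M : ℕ × ℕ → ℝ}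
    (hM : ∀ r t : ℝ, 0 ≤ r → r < 1 → 0 ≤ t → t < 1 →
      Summable fun p : ℕ × ℕ => |M p| * r ^ p.1 * t ^ p.2)
    {y : ℝ} (hy : |y| < 1) :
    AnalyticOnNhd ℝ (fun x : ℝ => ∑' p : ℕ × ℕ, M p * (-x) ^ p.1 * (-y) ^ p.2) (Ioo (-1) 1) := by
  intro x hx
  have hy' : |(-y)| < 1 := by rwa [abs_neg]
  have hT := analyticOnNhd_tsum_prod_fst hM hy' (-x) ⟨by linarith [hx.2], by linarith [hx.1]⟩
  exact hT.comp analyticAt_id.neg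

/-- `ρ̄ ↦ Σ M(a,b) (-ρ₀)^a (-ρ̄)^b` is real-analytic on `(-1,1)`. [folklore] -/
private theorem analyticOnNhd_tsum_neg_snd {M : ℕ × ℕ → ℝ}
    (hM : ∀ r t : ℝ, 0 ≤ r → r < 1 → 0 ≤ t → t < 1 →
      Summable fun p : ℕ × ℕ => |M p| * r ^ p.1 * t ^ p.2)
    {x : ℝ} (hx : |x| < 1) :
    AnalyticOnNhd ℝ (fun y : ℝ => ∑' p : ℕ × ℕ, M p * (-x) ^ p.1 * (-y) ^ p.2) (Ioo (-1) 1) := by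
  intro y hy
  have hx' : |(-x)| < 1 := by rwa [abs_neg]
  have hT := analyticOnNhd_tsum_prod_snd hM hx' (-y) ⟨by linarith [hy.2], by linarith [hy.1]⟩
  exact hT.comp analyticAt_id.neg

/-- **Step (C): `G₁ = (-1)^ℓ T(-ρ,-ρ̄)` on the whole square `I²`**, `G₁` the `ρ`-frame function of the
`⟨σεσε⟩` block (`c = 0`), `T` the integer-exponent series of the table: the identity of step (B),
divided by `(ρρ̄)^α`, holds on `(0, 3-2√2)²` and both sides are separately analytic on `I`
(Hogervorst–Rychkov 2013 §3.1: continuation along the square). [cite: HogervorstRychkov2013, §3.1] -/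
theorem IsConformalBlock3D.blockRho_eq_signed_tsum {Δσ Δε Δ : ℝ} {ℓ : ℕ} {g₁ g₂ : ℝ → ℝ → ℝ}
    {w : ℕ × ℕ → ℝ} (hΔ : unitarityBound3D ℓ < Δ) (hreg : ¬ accidentalDegeneracy3D Δ ℓ)
    (hg₁ : IsConformalBlock3D (Δσ - Δε) (Δσ - Δε) Δ ℓ g₁)
    (hg₂ : IsConformalBlock3D (-(Δσ - Δε)) (Δσ - Δε) Δ ℓ g₂) (hw : RadialSupport ℓ w)
    (hp : ParitySupport ℓ w) (hρ : HasRadialExpansion ((Δσ - Δε) / 2) Δ w g₂) :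
    ∀ ρ ∈ Ioo (-(3 - 2 * Real.sqrt 2)) 1, ∀ ρb ∈ Ioo (-(3 - 2 * Real.sqrt 2)) 1,
      blockRho (Δσ - Δε) (Δσ - Δε) Δ 0 ℓ ρ ρb =
        (-1 : ℝ) ^ ℓ * ∑' q : ℕ × ℕ, radialIntArr ℓ (fun p => (4 : ℝ) ^ Δ * w p) q *
          (-ρ) ^ q.1 * (-ρb) ^ q.2 := by
  set s := Δσ - Δε with hs
  have hδ1 := radialHalf_lt_one
  have hδ0 := radialHalf_pos
  have hM := fun r t (hr0 : (0 : ℝ) ≤ r) (hr1 : r < 1) (ht0 : (0 : ℝ) ≤ t) (ht1 : t < 1) =>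
    hρ.summable_abs_radialIntArr hw hp hr0 hr1 ht0 ht1
  have h1 : IsConformalBlock3DAbove s s Δ ℓ g₁ :=
    (isConformalBlock3D_iff_above_of_isRegularPoint3D ⟨hΔ.ne', hreg⟩).mp hg₁
  refine eqOn_of_separatelyAnalyticOn (a := -(3 - 2 * Real.sqrt 2)) (b := 1) (a' := 0)
    (b' := 3 - 2 * Real.sqrt 2) (fun t ht => ⟨by linarith [ht.1], ht.2.trans hδ1⟩) hδ0
    (fun y hy => analyticOnNhd_blockRho_fst hΔ 0 hy.1 hy.2)
    (fun y hy => ?_) (fun x hx => analyticOnNhd_blockRho_snd hΔ 0 hx.1 hx.2) (fun x hx => ?_) ?_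
  · have hT := (analyticOnNhd_tsum_neg_fst hM (abs_lt.2 ⟨by linarith [hy.1], hy.2⟩)).mono
      (s := Ioo (-(3 - 2 * Real.sqrt 2)) 1) fun t ht => ⟨by linarith [ht.1], ht.2⟩
    intro t ht
    exact analyticAt_const.mul (hT t ht)
  · have hT := (analyticOnNhd_tsum_neg_snd hM (abs_lt.2 ⟨by linarith [hx.1], hx.2⟩)).mono
      (s := Ioo (-(3 - 2 * Real.sqrt 2)) 1) fun t ht => ⟨by linarith [ht.1], ht.2⟩
    intro t ht
    exact analyticAt_const.mul (hT t ht)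
  -- agreement on `(0, 3-2√2)²`: step (B) at `(x,y) = (z(ρ), z(ρ̄)) ∈ (0,½)²`
  intro ρ hρJ ρb hρbJ
  have hρ1 : ρ < 1 := hρJ.2.trans hδ1
  have hρb1 : ρb < 1 := hρbJ.2.trans hδ1
  have hx : zOfRho ρ ∈ Ioo (0 : ℝ) 1 := ⟨zOfRho_pos hρJ.1, zOfRho_lt_one (by linarith [hρJ.1]) hρ1.ne⟩
  have hy : zOfRho ρb ∈ Ioo (0 : ℝ) 1 :=
    ⟨zOfRho_pos hρbJ.1, zOfRho_lt_one (by linarith [hρbJ.1]) hρb1.ne⟩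
  have hB := hg₁.eq_signed_tsum_of_lt_half hΔ hreg hg₂ hw hp hρ hx.1 (zOfRho_lt_half hρJ.1 hρJ.2)
    hy.1 (zOfRho_lt_half hρbJ.1 hρbJ.2)
  rw [rhoOf_zOfRho (by linarith [hρJ.1]) hρ1.le, rhoOf_zOfRho (by linarith [hρbJ.1]) hρb1.le] at hB
  -- `(ρρ̄)^α G₁(ρ,ρ̄) = g₁(z(ρ), z(ρ̄))`
  have hP := mul_blockRho_eq s s Δ 0 ℓ (mul_pos hρJ.1 hρbJ.1).le
  rw [Real.rpow_zero, one_mul, ← h1.eq_hrBlockAB hΔ hreg _ _ hx hy, hB] at hP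
  have hpos : 0 < (ρ * ρb) ^ ((Δ - (ℓ : ℝ)) / 2) := Real.rpow_pos_of_pos (mul_pos hρJ.1 hρbJ.1) _
  have hP' : (ρ * ρb) ^ ((Δ - (ℓ : ℝ)) / 2) * blockRho s s Δ 0 ℓ ρ ρb =
      (ρ * ρb) ^ ((Δ - (ℓ : ℝ)) / 2) * ((-1 : ℝ) ^ ℓ *
        ∑' q : ℕ × ℕ, radialIntArr ℓ (fun p => (4 : ℝ) ^ Δ * w p) q * (-ρ) ^ q.1 * (-ρb) ^ q.2) := by
    rw [hP]; ring
  exact mul_left_cancel₀ hpos.ne' hP'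

/-! ### (D) The signed radial expansion -/

/-- **Dolan–Osborn (2.23) in the radial frame, as a theorem: the signed expansion of the `⟨σεσε⟩`
block follows from the radial expansion of the `⟨εσσε⟩` block.** Let `(Δ, ℓ)` be regular and strictly
above the unitarity bound, `g₁`, `g₂` typed blocks with `(Δ₁₂,Δ₃₄) = (s,s)` and `(-s,s)`,
`s = Δσ - Δε`, and `w` a table supported on `j ≤ ℓ + m`. If `v^{s/2} g₂ = 4^Δ Σ w(m,j) 𝒫^ρ_{Δ+m,j}` on
the square (`HasRadialExpansion (s/2) Δ w g₂`), then `g₁ = 4^Δ Σ (-1)^m w(m,j) 𝒫^ρ_{Δ+m,j}` on the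
square (`HasSignedRadialExpansion Δ w g₁`). [cite: DolanOsborn2011, §2 eq. (2.23)] -/
theorem IsConformalBlock3D.hasSignedRadialExpansion_of_hasRadialExpansion {Δσ Δε Δ : ℝ} {ℓ : ℕ}
    {g₁ g₂ : ℝ → ℝ → ℝ} {w : ℕ × ℕ → ℝ} (hΔ : unitarityBound3D ℓ < Δ)
    (hreg : ¬ accidentalDegeneracy3D Δ ℓ) (hg₁ : IsConformalBlock3D (Δσ - Δε) (Δσ - Δε) Δ ℓ g₁)
    (hg₂ : IsConformalBlock3D (-(Δσ - Δε)) (Δσ - Δε) Δ ℓ g₂) (hw : RadialSupport ℓ w)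
    (hρ : HasRadialExpansion ((Δσ - Δε) / 2) Δ w g₂) : HasSignedRadialExpansion Δ w g₁ := by
  set s := Δσ - Δε with hs
  have hδ1 := radialHalf_lt_one
  have hp : ParitySupport ℓ w := hg₂.radial_paritySupport hΔ hreg rfl hw hρ
  have hM := fun r t (hr0 : (0 : ℝ) ≤ r) (hr1 : r < 1) (ht0 : (0 : ℝ) ≤ t) (ht1 : t < 1) =>
    hρ.summable_abs_radialIntArr hw hp hr0 hr1 ht0 ht1
  have h1 : IsConformalBlock3DAbove s s Δ ℓ g₁ :=
    (isConformalBlock3D_iff_above_of_isRegularPoint3D ⟨hΔ.ne', hreg⟩).mp hg₁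
  intro x y hx hy
  -- radial coordinates of the point
  have hρ0 : 0 < rhoOf x := rhoOf_pos hx.1
  have hρ1 : rhoOf x < 1 := rhoOf_lt_one hx.2
  have hρb0 : 0 < rhoOf y := rhoOf_pos hy.1
  have hρb1 : rhoOf y < 1 := rhoOf_lt_one hy.2
  have hzx : zOfRho (rhoOf x) = x := zOfRho_rhoOf hx.2.le
  have hzy : zOfRho (rhoOf y) = y := zOfRho_rhoOf hy.2.le
  have hρρ : 0 < rhoOf x * rhoOf y := mul_pos hρ0 hρb0
  -- the signed table and the summability of its radial series at the point
  have hS : Summable (fun q : ℕ × ℕ =>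
      ((4 : ℝ) ^ Δ * w q) * zMono (Δ + (q.1 : ℝ)) q.2 (rhoOf x) (rhoOf y)) :=
    (hρ.hasSum_zMono hρ0 hρ1 hρb0 hρb1).summable
  have hS' : Summable (fun q : ℕ × ℕ =>
      ((-1 : ℝ) ^ q.1 * ((4 : ℝ) ^ Δ * w q)) * zMono (Δ + (q.1 : ℝ)) q.2 (rhoOf x) (rhoOf y)) := by
    refine Summable.of_norm_bounded hS.abs fun q => le_of_eq ?_
    simp only [Real.norm_eq_abs, abs_mul, abs_pow, abs_neg, abs_one, one_pow, one_mul]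
  have hws' : RadialSupport ℓ (fun q : ℕ × ℕ => (-1 : ℝ) ^ q.1 * ((4 : ℝ) ^ Δ * w q)) :=
    fun q hq => by simp only [hw q hq, mul_zero]
  have hps' : ParitySupport ℓ (fun q : ℕ × ℕ => (-1 : ℝ) ^ q.1 * ((4 : ℝ) ^ Δ * w q)) :=
    fun q hq => by simp only [hp q hq, mul_zero]
  -- regroup the signed series in integer coordinates
  have hreg' := hasSum_radialIntArr_of_hasSum_zMono
    (d := fun q : ℕ × ℕ => (-1 : ℝ) ^ q.1 * ((4 : ℝ) ^ Δ * w q)) hws' hps' hρ0 hρb0 hS'.hasSum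
  have hsign : ∀ q : ℕ × ℕ,
      radialIntArr ℓ (fun p : ℕ × ℕ => (-1 : ℝ) ^ p.1 * ((4 : ℝ) ^ Δ * w p)) q *
          rhoOf x ^ q.1 * rhoOf y ^ q.2 =
        (-1 : ℝ) ^ ℓ * (radialIntArr ℓ (fun p : ℕ × ℕ => (4 : ℝ) ^ Δ * w p) q *
          (-rhoOf x) ^ q.1 * (-rhoOf y) ^ q.2) := by
    intro q
    rw [radialIntArr_signed ℓ (fun p : ℕ × ℕ => (4 : ℝ) ^ Δ * w p) q, neg_pow (rhoOf x),
      neg_pow (rhoOf y), pow_add, pow_add]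
    ring
  simp only [hsign] at hreg'
  -- the unsigned integer series converges at `(-ρ,-ρ̄)`
  have hT := (hasSum_tsum_of_abs hM (x := -rhoOf x) (y := -rhoOf y)
    (by rw [abs_neg, abs_of_pos hρ0]; exact hρ1)
    (by rw [abs_neg, abs_of_pos hρb0]; exact hρb1)).mul_left ((-1 : ℝ) ^ ℓ)
  have hEq := hreg'.unique hT
  -- step (C) at `(ρ, ρ̄)` and `(ρρ̄)^α G₁ = g₁`
  have hδ0 := radialHalf_pos
  have hC := hg₁.blockRho_eq_signed_tsum hΔ hreg hg₂ hw hp hρ (rhoOf x)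
    ⟨by linarith, hρ1⟩ (rhoOf y) ⟨by linarith, hρb1⟩
  have hP := mul_blockRho_eq s s Δ 0 ℓ hρρ.le
  rw [Real.rpow_zero, one_mul, hzx, hzy, ← h1.eq_hrBlockAB hΔ hreg _ _ hx hy, hC, ← hEq,
    ← mul_assoc, Real.rpow_neg hρρ.le, mul_inv_cancel₀ (Real.rpow_pos_of_pos hρρ _).ne',
    one_mul] at hP
  -- conclude
  have key : (fun q : ℕ × ℕ =>
      (4 : ℝ) ^ Δ * (-1 : ℝ) ^ q.1 * w q * radialMono (Δ + (q.1 : ℝ)) q.2 x y) =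
      fun q => ((-1 : ℝ) ^ q.1 * ((4 : ℝ) ^ Δ * w q)) * zMono (Δ + (q.1 : ℝ)) q.2 (rhoOf x) (rhoOf y) := by
    funext q
    simp only [radialMono]
    ring
  rw [key, ← hP]
  exact hS'.hasSum

/-- **The signed half of the radial block clause is redundant.** If at a regular `(Δ, ℓ)` strictly
above the unitarity bound every typed `⟨εσσε⟩` block `g^{-s,s}_{Δ,ℓ}` (`s = Δσ - Δε`) has a radial
expansion of its prefactored form `v^{s/2} g` with a non-negative table supported on `j ≤ ℓ + m`
(Costa–Hansen–Penedones–Trevisani 2016 eq. (2.11)), then `RadialPairClause Δσ Δε Δ ℓ` holds: the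
`⟨σεσε⟩` block carries the signed expansion with the same table (Dolan–Osborn 2011 eq. (2.23)).
[cite: DolanOsborn2011, §2 eq. (2.23)] -/
theorem radialPairClause_of_hasRadialExpansion {Δσ Δε Δ : ℝ} {ℓ : ℕ}
    (hΔ : unitarityBound3D ℓ < Δ) (hreg : ¬ accidentalDegeneracy3D Δ ℓ)
    (h : ∀ g₂ : ℝ → ℝ → ℝ, IsConformalBlock3D (-(Δσ - Δε)) (Δσ - Δε) Δ ℓ g₂ →
      ∃ wr : ℕ × ℕ → ℝ, (∀ q, 0 ≤ wr q) ∧ RadialSupport ℓ wr ∧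
        HasRadialExpansion ((Δσ - Δε) / 2) Δ wr g₂) :
    RadialPairClause Δσ Δε Δ ℓ := by
  intro g₁ g₂ hg₁ hg₂
  obtain ⟨wr, hw0, hws, hρ⟩ := h g₂ hg₂
  exact ⟨wr, hw0, hws, hg₁.hasSignedRadialExpansion_of_hasRadialExpansion hΔ hreg hg₂ hws hρ, hρ⟩

/-- The `z`-series instance: the Dolan–Osborn blocks `hrBlockAB s s Δ ℓ` and `hrBlockAB (-s) s Δ ℓ`
(`s = Δσ - Δε`). [cite: DolanOsborn2011, §2 eq. (2.23)] -/
theorem hasSignedRadialExpansion_hrBlockAB_of_hasRadialExpansion {Δσ Δε Δ : ℝ} {ℓ : ℕ}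
    {w : ℕ × ℕ → ℝ} (hΔ : unitarityBound3D ℓ < Δ) (hreg : ¬ accidentalDegeneracy3D Δ ℓ)
    (hw : RadialSupport ℓ w)
    (hρ : HasRadialExpansion ((Δσ - Δε) / 2) Δ w (hrBlockAB (-(Δσ - Δε)) (Δσ - Δε) Δ ℓ)) :
    HasSignedRadialExpansion Δ w (hrBlockAB (Δσ - Δε) (Δσ - Δε) Δ ℓ) :=
  (isConformalBlock3D_hrBlockAB hΔ hreg).hasSignedRadialExpansion_of_hasRadialExpansion hΔ hreg
    (isConformalBlock3D_hrBlockAB hΔ hreg) hw hρ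

/-! ### Identical scalars: only even radial levels (Hogervorst–Rychkov 2013 §3) -/

/-- **Equal external dimensions: the radial expansion is its own signed form.** For a typed block with
`Δ₁₂ = Δ₃₄ = 0` at a regular point above the bound, a supported table `w` with
`g = 4^Δ Σ w(m,j) 𝒫^ρ_{Δ+m,j}` on the square also gives `g = 4^Δ Σ (-1)^m w(m,j) 𝒫^ρ_{Δ+m,j}` there
(Dolan–Osborn 2011 eq. (2.23) at `a = b = 0`: `g(z,z̄) = (-1)^ℓ g(z/(z-1), z̄/(z̄-1))`, i.e. the block is
`ρ ↦ -ρ` symmetric up to `(-1)^ℓ`). [cite: DolanOsborn2011, §2 eq. (2.23)] -/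
theorem IsConformalBlock3D.hasSignedRadialExpansion_of_hasRadialExpansion_zero {Δ : ℝ} {ℓ : ℕ}
    {g : ℝ → ℝ → ℝ} {w : ℕ × ℕ → ℝ} (hΔ : unitarityBound3D ℓ < Δ)
    (hreg : ¬ accidentalDegeneracy3D Δ ℓ) (hg : IsConformalBlock3D 0 0 Δ ℓ g) (hw : RadialSupport ℓ w)
    (hρ : HasRadialExpansion 0 Δ w g) : HasSignedRadialExpansion Δ w g := by
  have hg' : IsConformalBlock3D ((0 : ℝ) - 0) ((0 : ℝ) - 0) Δ ℓ g := by rwa [sub_zero]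
  have hg'' : IsConformalBlock3D (-((0 : ℝ) - 0)) ((0 : ℝ) - 0) Δ ℓ g := by rwa [sub_zero, neg_zero]
  have hρ' : HasRadialExpansion (((0 : ℝ) - 0) / 2) Δ w g := by rwa [sub_zero, zero_div]
  exact hg'.hasSignedRadialExpansion_of_hasRadialExpansion hΔ hreg hg'' hw hρ'

/-- **Only even levels for equal external dimensions** (Hogervorst–Rychkov 2013 §3, after eq. (3.5):
"only even levels `n` will have nonzero `B_{n,j}`" — "the exchange `1 ↔ 2` corresponds to `z → z/(z-1)`,
which is equivalent to `ρ → -ρ`"), as a theorem about the typed blocks: for `Δ₁₂ = Δ₃₄ = 0` at a regular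
`(Δ, ℓ)` strictly above the unitarity bound, any table `w` supported on `j ≤ ℓ + m` with
`HasRadialExpansion 0 Δ w g` vanishes at every odd level `m` (uniqueness of the radial table applied to
`w` and `(-1)^m w`). [cite: HogervorstRychkov2013, §3 eqs. (3.4)–(3.5)] -/
theorem IsConformalBlock3D.radialTable_eq_zero_of_odd_level {Δ : ℝ} {ℓ : ℕ} {g : ℝ → ℝ → ℝ}
    {w : ℕ × ℕ → ℝ} (hΔ : unitarityBound3D ℓ < Δ) (hreg : ¬ accidentalDegeneracy3D Δ ℓ)
    (hg : IsConformalBlock3D 0 0 Δ ℓ g) (hw : RadialSupport ℓ w) (hρ : HasRadialExpansion 0 Δ w g)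
    {q : ℕ × ℕ} (hq : q.1 % 2 = 1) : w q = 0 := by
  have hs := hg.hasSignedRadialExpansion_of_hasRadialExpansion_zero hΔ hreg hw hρ
  rw [hasSignedRadialExpansion_iff] at hs
  have hw' : RadialSupport ℓ (fun p : ℕ × ℕ => (-1 : ℝ) ^ p.1 * w p) := hw.mul_left _
  have heq := congrFun (hρ.unique hs hw hw') q
  have hodd : Odd q.1 := Nat.odd_iff.mpr hq
  simp only [hodd.neg_one_pow] at heq
  linarith

/-- For equal external dimensions the radial table lives on spins of the parity of `ℓ`: `w(m,j) = 0`
unless `j ≡ ℓ (mod 2)` (even levels `m`, and `j ≡ ℓ + m` by `radial_paritySupport`; Hogervorst–Rychkov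
2013 §3: "only even spin states can be exchanged since the initial state is symmetric with respect to
`ρ → -ρ`", relative to the parity of `ℓ`). [cite: HogervorstRychkov2013, §3 eqs. (3.4)–(3.5)] -/
theorem IsConformalBlock3D.radialTable_eq_zero_of_spin_parity {Δ : ℝ} {ℓ : ℕ} {g : ℝ → ℝ → ℝ}
    {w : ℕ × ℕ → ℝ} (hΔ : unitarityBound3D ℓ < Δ) (hreg : ¬ accidentalDegeneracy3D Δ ℓ)
    (hg : IsConformalBlock3D 0 0 Δ ℓ g) (hw : RadialSupport ℓ w) (hρ : HasRadialExpansion 0 Δ w g)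
    {q : ℕ × ℕ} (hq : (ℓ + q.2) % 2 = 1) : w q = 0 := by
  by_cases hm : q.1 % 2 = 1
  · exact hg.radialTable_eq_zero_of_odd_level hΔ hreg hw hρ hm
  · have hp : ParitySupport ℓ w := hg.radial_paritySupport hΔ hreg (by rw [neg_zero]) hw hρ
    exact hp q (by omega)

end Literature.MathematicalPhysics.QuantumFieldTheory.ConformalBootstrap3D
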